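import Summits.QuantumFields.BalabanUV.Beta.GAN24.StaircaseLaplacianDefect

/-!
# G-an2-4 ∕ (CONV-C), road P2, route R2-S1 — THE SUP-NORM ONE-STEP LAW OF THE SCALAR SOFT MINIMISER `M = a′·G′·Q′*` AT `U = 1`,
# EXACTLY: `M′v − J·Mv = −G′_{RN}·(Δ′J − JΔ)·Mv = −Σ_μ G′∂′_μᴴ( ∂′_μᴴ(π^L_μ·J∂_μMv) + π^F_μ·J∂_μᴴ∂_μMv )`, hence
# `|(M′v)(x′) − (Mv)(par x′)| ≤ d·((R−1)∕(RN))·(‖G′∂′ᴴ∂′ᴴ‖_{∞→∞}·|∂Mv|_∞ + ‖G′∂′ᴴ‖_{∞→∞}·|∂ᴴ∂Mv|_∞)` — (O-pos) for the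
# fine-leg constituent «soft minimiser» REDUCED to four sup quantities (two (1.115)-type entries, two second-order entries)

Unit `b2b-balaban-gan24-p2` (gen 29), BINDER row G-an2-4 ∕ (CONV-C) («the non-abelian one-step η-rate comparison for the constituent
kernels (G_k, H_k, C^{(k)}) at U = 1 — not in print»), road P2; crux team (2).  The row's open substance (O-pos) of `beta/ROUTES-GAN24.md`
§0 (0.3) is the POSITION-SPACE one-step rate for FINE-LEG constituents; the NE2 lane proved the operator-norm law
(`BalabanMinimizerLaw.opNorm_Mtil_succ_sub_le`, rate `L^{−k}` in `ℓ²`), which loses `η^{−d/2}` when read pointwise.  THIS FILE treats the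
scalar prototype of Bałaban's soft solution operator `aGQ*` ([B5] (1.73); the hard `H_k` of (1.103) is the next file's `M·S⁻¹`) — King's soft minimiser `Mv = a′G′Q′*v` of `½‖∂u‖² + (a′/2)‖Q′u − v‖²` on
the NE2 carriers (`ScalarAveragedPropagator.DeltaPs∕Gps` = `Δ + a′Π′` and its inverse, `ScalarBlockPoincare.PiS`, `B5Blocks16.blockOf`):
 * §1 `blkInj n` (`Q′* : v ↦ v ∘ blockOf`, the `η^d`-weighted adjoint of `B5Block118.QsOp`), **`Msoft n a′ = a′·G′_n·blkInj n`**,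
   `Δ′_a(Mv) = a′·Q′*v`, and the two-level bookkeeping `J·Q′*_N = Q′*_{RN}` (`blockOf_par`), `Π′_{RN}·J = J·Π′_N` (`PiS_mul_JK0`);
 * §2 **`Msoft_succ_sub_stair`** — THE ONE-STEP IDENTITY `M′v − J(Mv) = −G′_{RN}·(Δ′(J Mv) − J(Δ Mv))` (the mass terms cancel EXACTLY:
   `Q′_{RN}J = Q′_N`-type intertwining), and with `StaircaseLaplacianDefect.LapS_stair_defect` its second-order form
   **`Msoft_succ_sub_stair_eq_sum`** `= −G′_{RN}·Σ_μ ∂′_μᴴ( ∂′_μᴴ(π^L_μ·J(∂_μMv)) + π^F_μ·J(∂_μᴴ∂_μMv) )`;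
 * §3 **`norm_Msoft_succ_sub_stair_le`** — THE SUP-NORM ONE-STEP LAW MODULO FOUR SUP QUANTITIES, in the sup → sup «letter» currency
   of the cell's interface modules (`|g| ≤ b ⟹ |(Tg)(x)| ≤ C·b`; `letter_of_row_sum` converts row `ℓ¹`-sums): if `G′_{RN}∂′_μᴴ∂′_μᴴ` is
   bounded by `B₁` and `G′_{RN}∂′_μᴴ` by `B₂`, and `|∂_μMv| ≤ m₁`, `|∂_μᴴ∂_μMv| ≤ m₂` pointwise, then for every `x′`
   `|(M′v)(x′) − (Mv)(par x′)| ≤ d·((R−1)∕(RN))·(B₁m₁ + B₂m₂)`; and **`norm_Msoft_succ_sub_stair_le_of_letters`** — with the coarse-level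
   letters `∂_μG′_N ≤ C₁`, `∂_μᴴ∂_μG′_N ≤ C₂` feeding `m₁ = C₁a′|v|_∞`, `m₂ = C₂a′|v|_∞` (`Msoft_mulVec`: `Mv = G′(a′Q′*v)`):
   `|(M′v)(x′) − (Mv)(par x′)| ≤ d·((R−1)∕(RN))·a′·(B₁C₁ + B₂C₂)·|v|_∞` — rate `η = N⁻¹` times the four letters.
READING FOR THE ROW (our analysis, not print; see `HOME/b2b-balaban-gan24-p2/gen29/`): `B₂` and `C₁` are the SCALAR [B5] (1.115) entries
`|G′∇*J| ≤ O(1)|J|`, `|∇G′J| ≤ O(1)|J|`; `B₁` (`G′∇*∇*`) and `C₂` (`∇*∇G′`, pure second differences) are SECOND-ORDER entries of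
Calderón–Zygmund type which carry at most `1 + log η⁻¹` (float diagnostics of the seat: `B₁ ≈ 1.44, 1.88, 2.30, 2.55` at `RN = 2, 4, 8, 12`,
`d = 2`; `|M′v − JMv|∕η` flat at `0.037`), so the law gives the SUMMABLE rate `k·L^{−k}` once they are supplied.  STATE OF THE LETTERS
(2026-08-21): for the VECTOR operator `Δ_1⁻¹` (`B5DeltaA169.DeltaA n M 1`) on CUBIC tori the first-order sup entries are in the tree
(`GAN24/Entry115SupCubic`, `Entry110GradCubic`, `Entry110GDivCubic`) and the second-order `(1 + log n)` entries are kernel-staged by the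
G-an2-4 swarm (leaf-03∕04, journal l.28917); for the SCALAR operator `Gps` used HERE none of the four is in the tree, and the scalar
zeroth-order sup entry («(s0)»: `n`-uniform block row sums of `Gps`) is the located gap (GAPS § L-gan24leaf03-g48-1) — the ℓ² bounds of
`ScalarAveragedPropagator`∕`CTScalarGreen` lose `η^{−d/2}` pointwise.  That supply is the located next rung of (O-pos) for this constituent.
HONEST SCOPE.  Scalar (0-form) prototype, `U = 1`, finite torus, every `d`, `N, R ≥ 1`, `a′ > 0`; §1–§2 are exact finite-lattice algebra,
§3 is the triangle inequality — the four letters are DISPLAYED HYPOTHESES on explicit tree objects (no `def … : Prop` binder, no named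
fact), NOT discharged here; nothing of Bałaban's is asserted, nothing printed is a hypothesis (ABSOLUTE RULE).  Locators (text only):
[Balaban1984PropagatorsI] (1.73) p. 30, (1.103) p. 34, (1.115) p. 36; [King1986] Prop. 3.8 (3.71) p. 664.  NOT (CONV-C), NEVER «G-an2-4 closed», NOT NE2,
NOT D1, NOT BetaPertH, NOT continuum, NOT Clay; not in print — our proof attempt.  HONEST DEPENDENCY: continuum YM on T⁴ ⇐ BetaPertH ∧ nine
spine estimates (0/9 proved); BetaPertH ⇐ (D1) ∧ (D4) ∧ CAP+tail; G-an2-4 gates asym, D1 and NE2/3/4.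
v1.1 (DOCFIX, XREAD C-gan24leaf02-g43-1 NIT-1): the locator of `Msoft` corrected from (1.103) (hard) to (1.73) p. 30 (soft); code byte-identical.
-/

noncomputable section

open scoped BigOperators ComplexConjugate Matrix

namespace Summit.QuantumFields.BalabanUV.Beta.GAN24.SoftMinimiserOneStepSup

open Literature.MathematicalPhysics.QuantumFieldTheory.Balaban1983to89.B5Prop11Plancherel (Tor fine unitVec)
open Literature.MathematicalPhysics.QuantumFieldTheory.Balaban1983to89.B5Action121 (sdiff LapS)
open Literature.MathematicalPhysics.QuantumFieldTheory.Balaban1983to89.B5Blocks16 (blockOf)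
open Summit.QuantumFields.BalabanUV.T4Continuum.BalabanAveragedTowerModes (par)
open Summit.QuantumFields.BalabanUV.T4Continuum.ScalarBlockPoincare (PiS)
open Summit.QuantumFields.BalabanUV.T4Continuum.ScalarAveragedPropagator (DeltaPs Gps Gps_mul_DeltaPs DeltaPs_mul_Gps)
open Summit.QuantumFields.BalabanUV.T4Continuum.ScalarBlockPlanting (Qavg0 JK0)
open Summit.QuantumFields.BalabanUV.T4Continuum.ScalarPlantingDefect (blockOf_par PiS_mul_JK0)
open Summit.QuantumFields.BalabanUV.Beta.GAN24.StaircaseLaplacianDefect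

variable {d : ℕ}

/-! ## §1 The unit-lattice staircase `Q′*`, the soft minimiser, and the two-level bookkeeping -/

section Unit

variable (n : ℕ) [NeZero n] (M : Fin d → ℕ) [hM : ∀ μ, NeZero (M μ)]

/-- `Q′*`: the unit-lattice-to-fine-lattice staircase `(blkInj n)(x, y) = [blockOf x = y]` (the `η^d`-weighted adjoint `n^d·Q′ᴴ` of the
block averaging `B5Block118.QsOp`). [cite: Balaban1984PropagatorsI, (1.20) p.20] [folklore] -/
def blkInj : Matrix (Tor (fine n M)) (Tor M) ℂ := fun x y => if blockOf n M x = y then 1 else 0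

/-- `(Q′*v)(x) = v(blockOf x)`. [folklore] -/
theorem blkInj_mulVec (v : Tor M → ℂ) (x : Tor (fine n M)) : (blkInj n M *ᵥ v) x = v (blockOf n M x) := by
  simp only [Matrix.mulVec, dotProduct, blkInj, ite_mul, one_mul, zero_mul, Finset.sum_ite_eq, Finset.mem_univ, if_true]

/-- **THE SCALAR SOFT MINIMISER** `M_n = a′·G′_n·Q′*` (the minimiser `u = Mv` of `½‖∂u‖² + (a′/2)‖Q′u − v‖²`, i.e. the solution of
`(Δ + a′Π′)u = a′Q′*v`): the scalar prototype of the SOFT solution operator `aG_kQ_k^*` of [B5] (1.73) («Δ_a A = J» at `J = aQ*B`; the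
HARD minimiser `GQ*(QGQ*)⁻¹` of (1.103) is `HardMinimiserOneStepSup.Mhard`) ∕ King's `a_kG_kQ_k^*`. [cite: Balaban1984PropagatorsI, (1.73) p.30]
[folklore] -/
def Msoft (a' : ℝ) : Matrix (Tor (fine n M)) (Tor M) ℂ := (a' : ℂ) • (Gps n M a' * blkInj n M)

/-- `Δ′_a(Mv) = a′·Q′*v`. [folklore] -/
theorem DeltaPs_mulVec_Msoft {a' : ℝ} (ha' : 0 < a') (v : Tor M → ℂ) :
    DeltaPs n M a' *ᵥ (Msoft n M a' *ᵥ v) = (a' : ℂ) • (blkInj n M *ᵥ v) := by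
  rw [Msoft, Matrix.smul_mulVec, Matrix.mulVec_smul, Matrix.mulVec_mulVec, ← Matrix.mul_assoc, DeltaPs_mul_Gps n M ha',
    Matrix.one_mul]

end Unit

section TwoLevel

variable (N R : ℕ) [NeZero N] [NeZero R] (M : Fin d → ℕ) [hM : ∀ μ, NeZero (M μ)]

/-- **`J·Q′*_N = Q′*_{RN}`**: the staircase of a unit-block-constant field is the finer unit-block-constant field (`blockOf_par`).
[folklore] -/
theorem stair_mulVec_blkInj (v : Tor M → ℂ) : stair N R M *ᵥ (blkInj N M *ᵥ v) = blkInj (R * N) M *ᵥ v := by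
  funext x
  rw [stair_mulVec, blkInj_mulVec, blkInj_mulVec, blockOf_par]

/-- **`Π′_{RN}·J = J·Π′_N`** for the plain staircase (from `ScalarPlantingDefect.PiS_mul_JK0`, `J = R^d·Q₀ᴴ`, `J₀ = √(R^d)·Q₀ᴴ`).
[folklore] -/
theorem PiS_mul_stair : PiS (R * N) M * stair N R M = stair N R M * PiS N M := by
  have hRd : (0 : ℝ) < (R : ℝ) ^ d := pow_pos (by exact_mod_cast Nat.pos_of_ne_zero (NeZero.ne R)) d
  have hs : ((((Real.sqrt ((R : ℝ) ^ d)) : ℝ) : ℂ)) ≠ 0 :=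
    Complex.ofReal_ne_zero.mpr (Real.sqrt_pos.mpr hRd).ne'
  have h := PiS_mul_JK0 N R M
  rw [JK0, Matrix.mul_smul, Matrix.smul_mul] at h
  have h' := congrArg (fun X => ((((Real.sqrt ((R : ℝ) ^ d)) : ℝ) : ℂ))⁻¹ • X) h
  simp only [smul_smul, inv_mul_cancel₀ hs, one_smul] at h'
  rw [stair_eq_smul_Qavg0H, Matrix.mul_smul, Matrix.smul_mul, h']

/-- `Π′_{RN}(Ju) = J(Π′_Nu)`. [folklore] -/
theorem PiS_mulVec_stair (u : Tor (fine N M) → ℂ) :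
    PiS (R * N) M *ᵥ (stair N R M *ᵥ u) = stair N R M *ᵥ (PiS N M *ᵥ u) := by
  rw [Matrix.mulVec_mulVec, Matrix.mulVec_mulVec, PiS_mul_stair]

/-! ## §2 The one-step identity -/

/-- **THE ONE-STEP IDENTITY OF THE SOFT MINIMISER**: `M′v − J(Mv) = −G′_{RN}·(Δ′(J·Mv) − J(Δ·Mv))` — the mass terms cancel exactly
(`Π′_{RN}J = JΠ′_N`, `J Q′*_N = Q′*_{RN}`), only the Laplacian defect of the staircase survives. [folklore] -/
theorem Msoft_succ_sub_stair {a' : ℝ} (ha' : 0 < a') (v : Tor M → ℂ) :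
    Msoft (R * N) M a' *ᵥ v - stair N R M *ᵥ (Msoft N M a' *ᵥ v)
      = -(Gps (R * N) M a' *ᵥ
          (LapS (fine (R * N) M) ((R * N : ℕ) : ℂ) *ᵥ (stair N R M *ᵥ (Msoft N M a' *ᵥ v))
            - stair N R M *ᵥ (LapS (fine N M) ((N : ℕ) : ℂ) *ᵥ (Msoft N M a' *ᵥ v)))) := by
  set u := Msoft N M a' *ᵥ v with hu_def
  set u' := Msoft (R * N) M a' *ᵥ v with hu'_def
  have hu : DeltaPs N M a' *ᵥ u = (a' : ℂ) • (blkInj N M *ᵥ v) := DeltaPs_mulVec_Msoft N M ha' v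
  have hu' : DeltaPs (R * N) M a' *ᵥ u' = (a' : ℂ) • (blkInj (R * N) M *ᵥ v) := DeltaPs_mulVec_Msoft (R * N) M ha' v
  -- the mass term of `u`, from its equation
  have hPi : (a' : ℂ) • (PiS N M *ᵥ u) = (a' : ℂ) • (blkInj N M *ᵥ v) - LapS (fine N M) ((N : ℕ) : ℂ) *ᵥ u := by
    rw [DeltaPs, Matrix.add_mulVec, Matrix.smul_mulVec] at hu
    rw [← hu]; abel
  -- `Δ′_a(Ju) = E + Δ′_a u′`
  have h1 : DeltaPs (R * N) M a' *ᵥ (stair N R M *ᵥ u)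
      = (LapS (fine (R * N) M) ((R * N : ℕ) : ℂ) *ᵥ (stair N R M *ᵥ u) - stair N R M *ᵥ (LapS (fine N M) ((N : ℕ) : ℂ) *ᵥ u))
        + DeltaPs (R * N) M a' *ᵥ u' := by
    rw [hu', DeltaPs, Matrix.add_mulVec, Matrix.smul_mulVec, PiS_mulVec_stair, ← Matrix.mulVec_smul, hPi, Matrix.mulVec_sub,
      Matrix.mulVec_smul, stair_mulVec_blkInj]
    abel
  have h2 : DeltaPs (R * N) M a' *ᵥ (stair N R M *ᵥ u - u')
      = LapS (fine (R * N) M) ((R * N : ℕ) : ℂ) *ᵥ (stair N R M *ᵥ u) - stair N R M *ᵥ (LapS (fine N M) ((N : ℕ) : ℂ) *ᵥ u) := by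
    rw [Matrix.mulVec_sub, h1]; abel
  have h3 : stair N R M *ᵥ u - u'
      = Gps (R * N) M a' *ᵥ (LapS (fine (R * N) M) ((R * N : ℕ) : ℂ) *ᵥ (stair N R M *ᵥ u)
          - stair N R M *ᵥ (LapS (fine N M) ((N : ℕ) : ℂ) *ᵥ u)) := by
    rw [← h2, Matrix.mulVec_mulVec _ (Gps (R * N) M a') (DeltaPs (R * N) M a'), Gps_mul_DeltaPs (R * N) M ha',
      Matrix.one_mulVec]
  rw [← neg_sub, h3]

/-- **THE ONE-STEP IDENTITY, SECOND-ORDER FORM**: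
`M′v − J(Mv) = −G′_{RN}·Σ_μ ∂′_μᴴ( ∂′_μᴴ(π^L_μ·J(∂_μMv)) + π^F_μ·J(∂_μᴴ∂_μMv) )`. [folklore] -/
theorem Msoft_succ_sub_stair_eq_sum {a' : ℝ} (ha' : 0 < a') (v : Tor M → ℂ) :
    Msoft (R * N) M a' *ᵥ v - stair N R M *ᵥ (Msoft N M a' *ᵥ v)
      = -(Gps (R * N) M a' *ᵥ ∑ μ, (sdiff (fine (R * N) M) ((R * N : ℕ) : ℂ) μ)ᴴ *ᵥ
          (((sdiff (fine (R * N) M) ((R * N : ℕ) : ℂ) μ)ᴴ *ᵥ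
              (fun z => piL N R M μ z * (stair N R M *ᵥ (sdiff (fine N M) ((N : ℕ) : ℂ) μ *ᵥ (Msoft N M a' *ᵥ v))) z))
            + (fun z => piF N R M μ z * (stair N R M *ᵥ ((sdiff (fine N M) ((N : ℕ) : ℂ) μ)ᴴ *ᵥ
                (sdiff (fine N M) ((N : ℕ) : ℂ) μ *ᵥ (Msoft N M a' *ᵥ v)))) z))) := by
  rw [Msoft_succ_sub_stair N R M ha', LapS_stair_defect]

/-! ## §3 The sup-norm one-step law modulo four sup LETTERS

The hypotheses below are written in the «letter» currency of the cell's (1.110)∕(1.115) interface modules (`B5Prop12Entries110`,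
`GAN24/Entry115SupCubic`): an operator `T` is controlled by `∀ g b, (∀ y, ‖g y‖ ≤ b) → ∀ x, ‖(T g)(x)‖ ≤ C·b` (sup → sup), which is
the row `ℓ¹`-sum bound `Σ_y ‖T(x,y)‖ ≤ C` read on test fields (`letter_of_row_sum`). -/

omit [NeZero N] [NeZero R] hM in
/-- rows with `ℓ¹`-sum `Σ_y ‖A(x,y)‖` applied to a field bounded by `F` give `|(Af)(x)| ≤ (Σ_y ‖A(x,y)‖)·F`. [folklore] -/
theorem norm_mulVec_apply_le {m k : Type*} [Fintype k] (A : Matrix m k ℂ) (f : k → ℂ) (x : m) {F : ℝ} (hF : ∀ y, ‖f y‖ ≤ F) :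
    ‖(A *ᵥ f) x‖ ≤ (∑ y, ‖A x y‖) * F := by
  simp only [Matrix.mulVec, dotProduct, Finset.sum_mul]
  refine (norm_sum_le _ _).trans (Finset.sum_le_sum fun y _ => ?_)
  rw [norm_mul]
  exact mul_le_mul_of_nonneg_left (hF y) (norm_nonneg _)

omit [NeZero N] [NeZero R] hM in
/-- **row `ℓ¹`-sums ⇒ the sup → sup letter**: if every row of `A` has `Σ_y ‖A(x,y)‖ ≤ C`, then `|g| ≤ b ⟹ |(Ag)(x)| ≤ C·b` (the
column index type is assumed nonempty through `0`, so that `b ≥ 0` is forced by the hypothesis). [folklore] -/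
theorem letter_of_row_sum {m k : Type*} [Fintype k] [Zero k] (A : Matrix m k ℂ) {C : ℝ} (hA : ∀ x, ∑ y, ‖A x y‖ ≤ C)
    (g : k → ℂ) (b : ℝ) (hg : ∀ y, ‖g y‖ ≤ b) (x : m) : ‖(A *ᵥ g) x‖ ≤ C * b :=
  (norm_mulVec_apply_le A g x hg).trans (mul_le_mul_of_nonneg_right (hA x) ((norm_nonneg _).trans (hg 0)))

omit [NeZero N] [NeZero R] hM in
/-- the abstract regrouping `G·D·(D·g₁ + g₂) = G·D·D·g₁ + G·D·g₂` through two sup → sup letters: if `|g| ≤ b ⟹ |(GDDg)(x)| ≤ B₁b`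
and `|g| ≤ b ⟹ |(GDg)(x)| ≤ B₂b`, and `|g₁| ≤ b₁`, `|g₂| ≤ b₂` pointwise, then `|(G(D(Dg₁ + g₂)))(x)| ≤ B₁b₁ + B₂b₂`. [folklore] -/
theorem norm_GDD_mulVec_apply_le {ι : Type*} [Fintype ι] (G D : Matrix ι ι ℂ) (g₁ g₂ : ι → ℂ) {B₁ B₂ b₁ b₂ : ℝ}
    (hB₁ : ∀ (g : ι → ℂ) (b : ℝ), (∀ y, ‖g y‖ ≤ b) → ∀ x, ‖(G *ᵥ (D *ᵥ (D *ᵥ g))) x‖ ≤ B₁ * b)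
    (hB₂ : ∀ (g : ι → ℂ) (b : ℝ), (∀ y, ‖g y‖ ≤ b) → ∀ x, ‖(G *ᵥ (D *ᵥ g)) x‖ ≤ B₂ * b)
    (hg₁ : ∀ y, ‖g₁ y‖ ≤ b₁) (hg₂ : ∀ y, ‖g₂ y‖ ≤ b₂) (x : ι) :
    ‖(G *ᵥ (D *ᵥ (D *ᵥ g₁ + g₂))) x‖ ≤ B₁ * b₁ + B₂ * b₂ := by
  rw [Matrix.mulVec_add, Matrix.mulVec_add, Pi.add_apply]
  exact (norm_add_le _ _).trans (add_le_add (hB₁ g₁ b₁ hg₁ x) (hB₂ g₂ b₂ hg₂ x))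

/-- the per-direction term through `G′`: `|G′∂′ᴴ(∂′ᴴ(π^L·J∂u) + π^F·J∂ᴴ∂u)(x′)| ≤ ((R−1)∕(RN))·(B₁m₁ + B₂m₂)` from the sup → sup letters
`B₁` of `G′∂′_μᴴ∂′_μᴴ`, `B₂` of `G′∂′_μᴴ` and the sup bounds `m₁` of `∂_μu`, `m₂` of `∂_μᴴ∂_μu` (any field `u` on the `η`-lattice).
[folklore] -/
theorem norm_dir_term_le (a' : ℝ) (μ : Fin d) (u : Tor (fine N M) → ℂ) {B₁ B₂ m₁ m₂ : ℝ}
    (hB₁ : ∀ (g : Tor (fine (R * N) M) → ℂ) (b : ℝ), (∀ y, ‖g y‖ ≤ b) → ∀ x,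
      ‖(Gps (R * N) M a' *ᵥ ((sdiff (fine (R * N) M) ((R * N : ℕ) : ℂ) μ)ᴴ *ᵥ
        ((sdiff (fine (R * N) M) ((R * N : ℕ) : ℂ) μ)ᴴ *ᵥ g))) x‖ ≤ B₁ * b)
    (hB₂ : ∀ (g : Tor (fine (R * N) M) → ℂ) (b : ℝ), (∀ y, ‖g y‖ ≤ b) → ∀ x,
      ‖(Gps (R * N) M a' *ᵥ ((sdiff (fine (R * N) M) ((R * N : ℕ) : ℂ) μ)ᴴ *ᵥ g)) x‖ ≤ B₂ * b)
    (hm₁ : ∀ z : Tor (fine N M), ‖(sdiff (fine N M) ((N : ℕ) : ℂ) μ *ᵥ u) z‖ ≤ m₁)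
    (hm₂ : ∀ z : Tor (fine N M), ‖((sdiff (fine N M) ((N : ℕ) : ℂ) μ)ᴴ *ᵥ (sdiff (fine N M) ((N : ℕ) : ℂ) μ *ᵥ u)) z‖ ≤ m₂)
    (x : Tor (fine (R * N) M)) :
    ‖(Gps (R * N) M a' *ᵥ ((sdiff (fine (R * N) M) ((R * N : ℕ) : ℂ) μ)ᴴ *ᵥ
        (((sdiff (fine (R * N) M) ((R * N : ℕ) : ℂ) μ)ᴴ *ᵥ
            (fun z => piL N R M μ z * (stair N R M *ᵥ (sdiff (fine N M) ((N : ℕ) : ℂ) μ *ᵥ u)) z))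
          + (fun z => piF N R M μ z * (stair N R M *ᵥ ((sdiff (fine N M) ((N : ℕ) : ℂ) μ)ᴴ *ᵥ
              (sdiff (fine N M) ((N : ℕ) : ℂ) μ *ᵥ u))) z)))) x‖
      ≤ (((R : ℝ) - 1) / ((R : ℝ) * N)) * (B₁ * m₁ + B₂ * m₂) := by
  have hR : 0 < R := Nat.pos_of_ne_zero (NeZero.ne R)
  have hR1 : (1 : ℝ) ≤ R := by exact_mod_cast hR
  have hρ : 0 ≤ ((R : ℝ) - 1) / ((R : ℝ) * N) := div_nonneg (by linarith) (by positivity)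
  -- the two source fields are `O(η)`
  have hg₁ : ∀ y, ‖(fun z => piL N R M μ z * (stair N R M *ᵥ (sdiff (fine N M) ((N : ℕ) : ℂ) μ *ᵥ u)) z) y‖
      ≤ (((R : ℝ) - 1) / ((R : ℝ) * N)) * m₁ := fun y => by
    dsimp only
    rw [norm_mul, stair_mulVec]
    exact mul_le_mul (norm_piL_le N R M μ y) (hm₁ _) (norm_nonneg _) hρ
  have hg₂ : ∀ y, ‖(fun z => piF N R M μ z *
      (stair N R M *ᵥ ((sdiff (fine N M) ((N : ℕ) : ℂ) μ)ᴴ *ᵥ (sdiff (fine N M) ((N : ℕ) : ℂ) μ *ᵥ u))) z) y‖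
      ≤ (((R : ℝ) - 1) / ((R : ℝ) * N)) * m₂ := fun y => by
    dsimp only
    rw [norm_mul, stair_mulVec]
    exact mul_le_mul (norm_piF_le N R M μ y) (hm₂ _) (norm_nonneg _) hρ
  -- regroup through `G′`
  calc _ ≤ B₁ * ((((R : ℝ) - 1) / ((R : ℝ) * N)) * m₁) + B₂ * ((((R : ℝ) - 1) / ((R : ℝ) * N)) * m₂) :=
        norm_GDD_mulVec_apply_le _ _ _ _ hB₁ hB₂ hg₁ hg₂ x
    _ = (((R : ℝ) - 1) / ((R : ℝ) * N)) * (B₁ * m₁ + B₂ * m₂) := by ring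

/-- **THE SUP-NORM ONE-STEP LAW OF THE SOFT MINIMISER, MODULO FOUR SUP QUANTITIES.**  Let `u = Mv` on the `η = N⁻¹` lattice and `M′v`
the soft minimiser on the `η/R` lattice.  If `G′_{RN}∂′_μᴴ∂′_μᴴ` is `ℓ^∞ → ℓ^∞` bounded by `B₁` and `G′_{RN}∂′_μᴴ` by `B₂` (every
direction `μ`, letter form), and `|∂_μu| ≤ m₁`, `|∂_μᴴ∂_μu| ≤ m₂` pointwise, then at every fine site `x′`
`|(M′v)(x′) − (Mv)(par x′)| ≤ d·((R−1)∕(RN))·(B₁m₁ + B₂m₂)` — rate `η` times the four constants. [folklore] -/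
theorem norm_Msoft_succ_sub_stair_le {a' : ℝ} (ha' : 0 < a') (v : Tor M → ℂ) {B₁ B₂ m₁ m₂ : ℝ}
    (hB₁ : ∀ (μ : Fin d) (g : Tor (fine (R * N) M) → ℂ) (b : ℝ), (∀ y, ‖g y‖ ≤ b) → ∀ x,
      ‖(Gps (R * N) M a' *ᵥ ((sdiff (fine (R * N) M) ((R * N : ℕ) : ℂ) μ)ᴴ *ᵥ
        ((sdiff (fine (R * N) M) ((R * N : ℕ) : ℂ) μ)ᴴ *ᵥ g))) x‖ ≤ B₁ * b)
    (hB₂ : ∀ (μ : Fin d) (g : Tor (fine (R * N) M) → ℂ) (b : ℝ), (∀ y, ‖g y‖ ≤ b) → ∀ x,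
      ‖(Gps (R * N) M a' *ᵥ ((sdiff (fine (R * N) M) ((R * N : ℕ) : ℂ) μ)ᴴ *ᵥ g)) x‖ ≤ B₂ * b)
    (hm₁ : ∀ (μ : Fin d) (z : Tor (fine N M)), ‖(sdiff (fine N M) ((N : ℕ) : ℂ) μ *ᵥ (Msoft N M a' *ᵥ v)) z‖ ≤ m₁)
    (hm₂ : ∀ (μ : Fin d) (z : Tor (fine N M)),
      ‖((sdiff (fine N M) ((N : ℕ) : ℂ) μ)ᴴ *ᵥ (sdiff (fine N M) ((N : ℕ) : ℂ) μ *ᵥ (Msoft N M a' *ᵥ v))) z‖ ≤ m₂)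
    (x : Tor (fine (R * N) M)) :
    ‖(Msoft (R * N) M a' *ᵥ v) x - (Msoft N M a' *ᵥ v) (par N R M x)‖
      ≤ d * (((R : ℝ) - 1) / ((R : ℝ) * N)) * (B₁ * m₁ + B₂ * m₂) := by
  have hpt : (Msoft (R * N) M a' *ᵥ v) x - (Msoft N M a' *ᵥ v) (par N R M x)
      = (Msoft (R * N) M a' *ᵥ v - stair N R M *ᵥ (Msoft N M a' *ᵥ v)) x := by
    rw [Pi.sub_apply, stair_mulVec]
  rw [hpt, Msoft_succ_sub_stair_eq_sum N R M ha', Pi.neg_apply, norm_neg]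
  simp only [Matrix.mulVec_sum, Finset.sum_apply]
  refine (norm_sum_le _ _).trans
    ((Finset.sum_le_sum fun μ _ => norm_dir_term_le N R M a' μ _ (hB₁ μ) (hB₂ μ) (hm₁ μ) (hm₂ μ) x).trans (le_of_eq ?_))
  rw [Finset.sum_const, Finset.card_univ, Fintype.card_fin, nsmul_eq_mul]
  ring

/-- `Mv = G′(a′·Q′*v)`: the soft minimiser is the propagator applied to the planted source `a′·Q′*v`, `|a′·Q′*v| ≤ a′·|v|_∞`.
[folklore] -/
theorem Msoft_mulVec (a' : ℝ) (v : Tor M → ℂ) : Msoft N M a' *ᵥ v = Gps N M a' *ᵥ ((a' : ℂ) • (blkInj N M *ᵥ v)) := by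
  rw [Msoft, Matrix.smul_mulVec, ← Matrix.mulVec_mulVec, Matrix.mulVec_smul]

/-- `|a′·(Q′*v)(y)| ≤ a′·V` when `|v| ≤ V` and `a′ ≥ 0`. [folklore] -/
theorem norm_smul_blkInj_mulVec_le {a' : ℝ} (ha' : 0 ≤ a') (v : Tor M → ℂ) {V : ℝ} (hv : ∀ y, ‖v y‖ ≤ V)
    (y : Tor (fine N M)) : ‖((a' : ℂ) • (blkInj N M *ᵥ v)) y‖ ≤ a' * V := by
  rw [Pi.smul_apply, blkInj_mulVec, norm_smul, Complex.norm_real, Real.norm_of_nonneg ha']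
  exact mul_le_mul_of_nonneg_left (hv _) ha'

/-- **THE SUP-NORM ONE-STEP LAW OF THE SOFT MINIMISER, MODULO FOUR SUP → SUP LETTERS.**  If on the finer lattice `G′_{RN}∂′_μᴴ∂′_μᴴ` is
`ℓ^∞ → ℓ^∞` bounded by `B₁` and `G′_{RN}∂′_μᴴ` by `B₂`, and on the coarser lattice `∂_μG′_N` by `C₁` and `∂_μᴴ∂_μG′_N` by `C₂` (every
direction, letter form — the scalar twins of the [B5] (1.115) entries `G∇*`, `∇G` and of the second-order entries `G∇*∇*`, `∇*∇G`),
then for `|v| ≤ V` and every fine site `x′`: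
`|(M′v)(x′) − (Mv)(par x′)| ≤ d·((R−1)∕(RN))·a′·(B₁C₁ + B₂C₂)·V`.  The letters are HYPOTHESES (not in the tree for the scalar
operator `Gps`; see the header). [folklore] -/
theorem norm_Msoft_succ_sub_stair_le_of_letters {a' : ℝ} (ha' : 0 < a') {B₁ B₂ C₁ C₂ V : ℝ}
    (hB₁ : ∀ (μ : Fin d) (g : Tor (fine (R * N) M) → ℂ) (b : ℝ), (∀ y, ‖g y‖ ≤ b) → ∀ x,
      ‖(Gps (R * N) M a' *ᵥ ((sdiff (fine (R * N) M) ((R * N : ℕ) : ℂ) μ)ᴴ *ᵥ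
        ((sdiff (fine (R * N) M) ((R * N : ℕ) : ℂ) μ)ᴴ *ᵥ g))) x‖ ≤ B₁ * b)
    (hB₂ : ∀ (μ : Fin d) (g : Tor (fine (R * N) M) → ℂ) (b : ℝ), (∀ y, ‖g y‖ ≤ b) → ∀ x,
      ‖(Gps (R * N) M a' *ᵥ ((sdiff (fine (R * N) M) ((R * N : ℕ) : ℂ) μ)ᴴ *ᵥ g)) x‖ ≤ B₂ * b)
    (hC₁ : ∀ (μ : Fin d) (f : Tor (fine N M) → ℂ) (b : ℝ), (∀ y, ‖f y‖ ≤ b) → ∀ z,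
      ‖(sdiff (fine N M) ((N : ℕ) : ℂ) μ *ᵥ (Gps N M a' *ᵥ f)) z‖ ≤ C₁ * b)
    (hC₂ : ∀ (μ : Fin d) (f : Tor (fine N M) → ℂ) (b : ℝ), (∀ y, ‖f y‖ ≤ b) → ∀ z,
      ‖((sdiff (fine N M) ((N : ℕ) : ℂ) μ)ᴴ *ᵥ (sdiff (fine N M) ((N : ℕ) : ℂ) μ *ᵥ (Gps N M a' *ᵥ f))) z‖ ≤ C₂ * b)
    (v : Tor M → ℂ) (hv : ∀ y, ‖v y‖ ≤ V) (x : Tor (fine (R * N) M)) :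
    ‖(Msoft (R * N) M a' *ᵥ v) x - (Msoft N M a' *ᵥ v) (par N R M x)‖
      ≤ d * (((R : ℝ) - 1) / ((R : ℝ) * N)) * (a' * (B₁ * C₁ + B₂ * C₂) * V) := by
  have hsrc := norm_smul_blkInj_mulVec_le N M ha'.le v hv
  have hm₁ : ∀ (μ : Fin d) (z : Tor (fine N M)),
      ‖(sdiff (fine N M) ((N : ℕ) : ℂ) μ *ᵥ (Msoft N M a' *ᵥ v)) z‖ ≤ C₁ * (a' * V) := fun μ z => by
    rw [Msoft_mulVec]; exact hC₁ μ _ _ hsrc z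
  have hm₂ : ∀ (μ : Fin d) (z : Tor (fine N M)),
      ‖((sdiff (fine N M) ((N : ℕ) : ℂ) μ)ᴴ *ᵥ (sdiff (fine N M) ((N : ℕ) : ℂ) μ *ᵥ (Msoft N M a' *ᵥ v))) z‖
        ≤ C₂ * (a' * V) := fun μ z => by
    rw [Msoft_mulVec]; exact hC₂ μ _ _ hsrc z
  calc _ ≤ d * (((R : ℝ) - 1) / ((R : ℝ) * N)) * (B₁ * (C₁ * (a' * V)) + B₂ * (C₂ * (a' * V))) :=
        norm_Msoft_succ_sub_stair_le N R M ha' v hB₁ hB₂ hm₁ hm₂ x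
    _ = d * (((R : ℝ) - 1) / ((R : ℝ) * N)) * (a' * (B₁ * C₁ + B₂ * C₂) * V) := by ring

end TwoLevel

end Summit.QuantumFields.BalabanUV.Beta.GAN24.SoftMinimiserOneStepSup

end
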